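import Literature.MathematicalPhysics.QuantumFieldTheory.Balaban1983to89.B10Eq47AxialChi
import Summits.QuantumFields.Balaban3D.Proofs.Inputs

/-!
# Route «BalabanUVNodes» (cluster K3), Track-A DAG node N08 = [Balaban1985UV3] Thm 2 p. 272 — **(47) AS PRINTED (print's `χ_k`) ON
# THE d = 3 LANE'S CONSTRUCTED TOWERS**, from the (41)∕(47) slot of the construction (what `B10.Thm2Printed` delivers for the pinned
# family) plus the constraint (42) at the trivial history for the minimizer data — the knit of
# `Literature.…Balaban1983to89.B10Eq47AxialChi` (G3D-09 `Chi47SubChi4` for axially averaged towers) onto `Balaban3D.Carriers.TowerInput.tower3`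

Cell `pub-ymgap` (HUMAN RULING D-0062), seat `pub-ymgap-dag-n08-b` (-b lane of node N08), generation 2, FILE 2; `bears_on: R4∕N08`; filed
`--supports stmt-QuantumFields-19183`.  THEOREMS ONLY: def-free, sorry-free, standard axioms.

WHAT PRINT SAYS.  Theorem 2 p. 272: «The sequence of densities ρ_k defined by the inductive equations (2), with ρ₀ given by (1), satisfies
the inequalities (41), (47).»; (47) p. 267 L17–20 carries «the characteristic function χ_k [which] corresponds to the restrictions on V
given by the conditions |U_k(∂p) − 1| < g_kp(g_k)η², p ⊂ T_η» — the MINIMIZER's plaquettes —, whereas the tree's `B10.Ineq47` ∕ the spine's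
`SectB.TowerObjects.Ineq47AsPrinted` (and hence the (41)∕(47) slot `ineq41_47` of the lane's pinned towers `tower3`, which is what
`B10.Thm2Printed` reads through `B10.SpecOK`) carry the Introduction's `χ` of (4) at `ε₁(k)` (cell pub-balaban GAPS G-pv15-1; lane
pub-balaban3d row G3D-09).

WHAT THIS FILE PROVES.  For ANY tower input `D : Balaban3D.Carriers.TowerInput S G` of the d = 3 lane whose averaging operations are the
axial decimation in the standing range (`hav`; in particular the lane's STANDARD external inputs `ExternalInputs.ofStd`, whose averaging is
`AveragingRT.stdAvg` — §3), whose trivial-history minimizer data `D.UkH k (Hist.triv)` = «U_k(V)» satisfy the constraint (42) p. 266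
«Ū^k = V» (`hcons`, hypothesis on DATA: what the minimizer of [Balaban1985Variational] Thm 1 satisfies by construction) and whose thresholds
satisfy `g_kp(g_k) ≤ ε₁(k)` (`hthr`; `le_rfl` for the standard inputs, `Carriers.eps1Of`), the slot `(41)_k ∧ (47)_k` of `D.tower3` at step
`k ≤ K` implies **(47) with print's own `χ_k`** for the constructed densities (`SectB.TowerObjects.Ineq47Literal D.tower3 k`):
§1 `ineq47Literal_tower3_of_slot` (axial form) ∕ `…_of_slot_av` ((42) read for `D.av`); §2 the family form from `B10.Thm2Printed`
(`ineq47Literal_of_thm2Printed`); §3 the standard external inputs (`ineq47Literal_std_of_thm2Printed`) and the lane's `Inputs.inputOf 𝔎 X 𝔖`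
(`ineq47Literal_inputOf_of_thm2Printed`, the towers of n08-a's T4 `BalabanUVNodesN08Constructed` pin candidate); §4 the same for (37) p. 265
(Sect. A's lower bound with its own `χ₁`, print's ⟦sic⟧ threshold `L⁻²g₀p(g₁)`): the threshold comparison `g₀p(g₁) ≤ g₁p(g₁)` that
`SectBLowerBound.ineq37Literal_of_ineq47Literal_one` takes as a hypothesis is DISCHARGED for the spine's approximations (`g_k` increasing in `k`,
`ScalesArithmetic.gk_mono`), so (47)₁ AS PRINTED ⇒ (37) AS PRINTED (`ineq37Literal_of_ineq47Literal_one`, `ineq37Literal_tower3_of_slot`).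
HONEST FRAMING: count-neutral kernel bookkeeping; `hcons` is a hypothesis on the minimizer data (in-edge b11 ∕ the B10-pin's `wilsonBG_spec`
shape), `Thm2Printed` ∕ the slot is a HYPOTHESIS (the lane proves it modulo its (α) rows); nothing of [B10] is asserted; `Dag.B10_main`
untouched; d = 3 finite tori; nothing continuum ∕ ℝ⁴ ∕ OS ∕ mass gap ∕ Clay.
-/

namespace Summit.QuantumFields.YangMills.Theorems.BalabanUVNodesN08Ineq47AsPrinted

open Literature.MathematicalPhysics.QuantumFieldTheory.Balaban1983to89
open Literature.MathematicalPhysics.QuantumFieldTheory.Balaban1983to89.B10Eq47AxialChi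
  (axialUp avgUp avgUp_eq_axialUp stdAvg_avg_of_le ineq47Literal_of_slot_pin chi47SubChi4_of_axial)
open Literature.MathematicalPhysics.QuantumFieldTheory.Balaban1985CMP102
open Literature.MathematicalPhysics.QuantumFieldTheory.Balaban1985CMP102.Setting
open Summit.QuantumFields.Balaban3D.Carriers
open Summit.QuantumFields.Balaban3D.Proofs.Inputs
open Summit.QuantumFields.Balaban3D.Proofs (ScalesArithmetic.gk_mono ScalesArithmetic.gk_pos ScalesArithmetic.gk_le_one)

variable {L : ℕ} {S : Scales L} {G : Type} [GaugeGroup G] [MeasurableSpace G] [HaarData G]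

/-! ## §1 One tower input: the slot `(41)_k ∧ (47)_k` of `tower3` + (42) ⇒ (47) AS PRINTED -/

/-- **(47) AS PRINTED ON `D.tower3` FROM ITS SLOT, axial form of (42).**  For a tower input `D` of the lane, if the trivial-history
minimizer data satisfy `axialUp k (U_k(V)) = V` on `T₁^{(k)}` ((42) p. 266 for the axial decimation) and `g_kp(g_k) ≤ ε₁(k)`, then the
pinned slot `D.tower3.ineq41_47 k` (= `(41)_k ∧ (47)_k` of the stage-1 tower, `Carriers.TowerInput.tower3 = (towerWith ⊤).pin`) yields
(47) p. 267 with print's `χ_k` for the constructed densities, `k ≤ m + K`. [cite: Balaban1985UV3, (47) p.267 + (42) p.266 + Thm 2 p.272] -/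
theorem ineq47Literal_tower3_of_slot (D : TowerInput S G) (k : ℕ) (hk : k ≤ S.m + S.K)
    (hcons : ∀ V : GaugeField S.P k G, axialUp k (D.UkH k (Hist.triv S.P k) V) = V)
    (hthr : S.gk k * B10.pFun D.b₀ D.p₀ (S.gk k) ≤ D.ε₁ k) (hslot : D.tower3.ineq41_47 k) :
    D.tower3.Ineq47Literal k :=
  ((D.towerWith fun _ => True).ineq47Literal_pin_iff k).2
    (ineq47Literal_of_slot_pin (D.towerWith fun _ => True) k hk hcons hthr hslot)

/-- The `k`-fold average by the run's averaging operations depends only on those operations. [folklore] -/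
private theorem avgUp_congr {R R' : RunObjects S G} (h : R.av = R'.av) :
    ∀ (k : ℕ) (U : GaugeField S.P 0 G), avgUp R k U = avgUp R' k U
  | 0, _ => rfl
  | k + 1, U => by
    show (R.av k).avg (avgUp R k U) = (R'.av k).avg (avgUp R' k U)
    rw [avgUp_congr h k U, h]

/-- **(47) AS PRINTED ON `D.tower3` FROM ITS SLOT, (42) read for the run's OWN averaging `D.av`** (axial in the standing range, `hav`):
`hcons : avgUp D.tower3.toRunObjects k (U_k(V)) = V` is «Ū^k = V» of (42) with `\bar{·}` the constructed run's averaging.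
[cite: Balaban1985UV3, (47) p.267 + (42) p.266 + Thm 2 p.272] -/
theorem ineq47Literal_tower3_of_slot_av (D : TowerInput S G)
    (hav : ∀ i, i + 1 ≤ S.m + S.K → (D.av i).avg = AveragingRT.axialAvg) (k : ℕ) (hk : k ≤ S.m + S.K)
    (hcons : ∀ V : GaugeField S.P k G, avgUp D.tower3.toRunObjects k (D.UkH k (Hist.triv S.P k) V) = V)
    (hthr : S.gk k * B10.pFun D.b₀ D.p₀ (S.gk k) ≤ D.ε₁ k) (hslot : D.tower3.ineq41_47 k) :
    D.tower3.Ineq47Literal k :=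
  ineq47Literal_tower3_of_slot D k hk
    (fun V => by rw [← avgUp_eq_axialUp D.tower3.toRunObjects hav hk]; exact hcons V) hthr hslot

/-! ## §2 The family form: `B10.Thm2Printed` on the pinned towers ⇒ (47) AS PRINTED at every step -/

/-- **THEOREM 2 ON THE CONSTRUCTED FAMILY DELIVERS (47) AS PRINTED.**  For a family `D i` of tower inputs over lattice approximations
`Sc i` (one gauge group), axially averaging in the standing range, with (42) for the trivial-history minimizer data and
`g_kp(g_k) ≤ ε₁(k)`: `B10.Thm2Printed` for the family of pinned towers `(D i).tower3` (its conclusion at `(i, k)` IS the slot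
`(41)_k ∧ (47)_k`, `Carriers.TowerInput.tower3_specOK`) gives (47) p. 267 with print's `χ_k` for every `i` and `k ≤ K`.
[cite: Balaban1985UV3, Thm 2 p.272 + (47) p.267] -/
theorem ineq47Literal_of_thm2Printed {I : Type} (Sc : I → Scales L) (D : ∀ i, TowerInput (Sc i) G)
    (hav : ∀ i j, j + 1 ≤ (Sc i).m + (Sc i).K → ((D i).av j).avg = AveragingRT.axialAvg)
    (hcons : ∀ i k, k ≤ (Sc i).K → ∀ V : GaugeField (Sc i).P k G,
      avgUp (D i).tower3.toRunObjects k ((D i).UkH k (Hist.triv (Sc i).P k) V) = V)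
    (hthr : ∀ i k, k ≤ (Sc i).K → (Sc i).gk k * B10.pFun (D i).b₀ (D i).p₀ ((Sc i).gk k) ≤ (D i).ε₁ k)
    (h2 : B10.Thm2Printed fun i => (D i).tower3.toTowerRun.toRunData) (i : I) (k : ℕ) (hk : k ≤ (Sc i).K) :
    (D i).tower3.Ineq47Literal k :=
  ineq47Literal_tower3_of_slot_av (D i) (hav i) k (by omega) (hcons i k hk) (hthr i k hk) (h2 i k hk)

/-! ## §3 The lane's STANDARD external inputs (`AveragingRT.stdAvg`) and the towers of the B10-pin candidate -/

variable [MeasurableMul₂ G]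

/-- The standard external inputs average axially in the standing range (`B10Eq47AxialChi.stdAvg_avg_of_le`). [cite: Balaban1985Averaging, (15) p.19] -/
theorem stdTowerInput_ofStd_av_axial {V : Type} [NormedAddCommGroup V] [NormedSpace ℂ V]
    (reg : ℕ → Set (GaugeField S.P 0 G)) (Uk : (k : ℕ) → GaugeField S.P (k + 1) G → GaugeField S.P 0 G)
    (UkH : (k : ℕ) → Hist S.P k → GaugeField S.P k G → GaugeField S.P 0 G)
    (UkH_triv : ∀ (k : ℕ) (V : GaugeField S.P k G), UkH k (Hist.triv S.P k) V = ukAll Uk k V)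
    (K : CarrierConsts) (𝔖 : ∀ k, StepSeries S G V (nblkOf S K k) k) (j : ℕ) (hj : j + 1 ≤ S.m + S.K) :
    ((stdTowerInput (ExternalInputs.ofStd reg Uk UkH UkH_triv) K 𝔖).av j).avg = AveragingRT.axialAvg :=
  stdAvg_avg_of_le (S := S) hj

/-- **(47) AS PRINTED FOR THE STANDARD TOWERS FROM THEOREM 2.**  For tower inputs `stdTowerInput (ExternalInputs.ofStd …) K 𝔖` (the lane's
construction with the total standard averaging family — `Balaban3D.Carriers.ExternalInputs.ofStd`, `AveragingRT.stdAvg` — over ANY minimizer data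
`Uk`, `UkH` and expansion data `𝔖`), the threshold condition is an equality (`Carriers.eps1Of k = g_kp(g_k)`), so: (42) for the minimizer data at
the trivial history + `B10.Thm2Printed` for the pinned family ⇒ (47) with print's `χ_k`, every run and every `k ≤ K`.
[cite: Balaban1985UV3, Thm 2 p.272 + (47) p.267 + (42) p.266] -/
theorem ineq47Literal_std_of_thm2Printed {I : Type} (Sc : I → Scales L) {V : I → Type} [∀ i, NormedAddCommGroup (V i)]
    [∀ i, NormedSpace ℂ (V i)] (reg : ∀ i, ℕ → Set (GaugeField (Sc i).P 0 G))
    (Uk : ∀ i, (k : ℕ) → GaugeField (Sc i).P (k + 1) G → GaugeField (Sc i).P 0 G)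
    (UkH : ∀ i, (k : ℕ) → Hist (Sc i).P k → GaugeField (Sc i).P k G → GaugeField (Sc i).P 0 G)
    (UkH_triv : ∀ i (k : ℕ) (W : GaugeField (Sc i).P k G), UkH i k (Hist.triv (Sc i).P k) W = ukAll (Uk i) k W)
    (K : I → CarrierConsts) (𝔖 : ∀ i k, StepSeries (Sc i) G (V i) (nblkOf (Sc i) (K i) k) k)
    (hcons : ∀ i k, k ≤ (Sc i).K → ∀ W : GaugeField (Sc i).P k G,
      avgUp (stdTowerInput (ExternalInputs.ofStd (reg i) (Uk i) (UkH i) (UkH_triv i)) (K i) (𝔖 i)).tower3.toRunObjects k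
        (UkH i k (Hist.triv (Sc i).P k) W) = W)
    (h2 : B10.Thm2Printed fun i =>
      (stdTowerInput (ExternalInputs.ofStd (reg i) (Uk i) (UkH i) (UkH_triv i)) (K i) (𝔖 i)).tower3.toTowerRun.toRunData)
    (i : I) (k : ℕ) (hk : k ≤ (Sc i).K) :
    (stdTowerInput (ExternalInputs.ofStd (reg i) (Uk i) (UkH i) (UkH_triv i)) (K i) (𝔖 i)).tower3.Ineq47Literal k :=
  ineq47Literal_of_thm2Printed Sc
    (fun i => stdTowerInput (ExternalInputs.ofStd (reg i) (Uk i) (UkH i) (UkH_triv i)) (K i) (𝔖 i))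
    (fun i j hj => stdTowerInput_ofStd_av_axial (reg i) (Uk i) (UkH i) (UkH_triv i) (K i) (𝔖 i) j hj)
    hcons (fun _ _ _ => le_rfl) h2 i k hk

omit [MeasurableMul₂ G] in
/-- **THE TOWERS OF THE B10-PIN CANDIDATE** (n08-a T4 `BalabanUVNodesN08Constructed`: `runs10 := fun S ↦ (Inputs.towerOf 𝔠.lane (X S) (𝔖 S)).toRunData`):
`Inputs.towerOf 𝔎 X 𝔖 = (Inputs.inputOf 𝔎 X 𝔖).tower3.toTowerRun` with `inputOf = stdTowerInput X 𝔎.carrier 𝔖`; so for external inputs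
`X S` averaging axially in the standing range, (42) at the trivial history and `B10.Thm2Printed` for `fun S ↦ (towerOf 𝔎 (X S) (𝔖 S)).toRunData`
give (47) with print's `χ_k` on every run of the family and every `k ≤ K`. [cite: Balaban1985UV3, Thm 2 p.272 + (47) p.267 + (42) p.266] -/
theorem ineq47Literal_inputOf_of_thm2Printed {I : Type} (Sc : I → Scales L) (𝔎 : LaneConsts L) {V : I → Type}
    [∀ i, NormedAddCommGroup (V i)] [∀ i, NormedSpace ℂ (V i)] (X : ∀ i, ExternalInputs (Sc i) G)
    (𝔖 : ∀ i k, StepSeries (Sc i) G (V i) (nblkOf (Sc i) 𝔎.carrier k) k)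
    (hav : ∀ i j, j + 1 ≤ (Sc i).m + (Sc i).K → ((X i).av j).avg = AveragingRT.axialAvg)
    (hcons : ∀ i k, k ≤ (Sc i).K → ∀ W : GaugeField (Sc i).P k G,
      avgUp (inputOf 𝔎 (X i) (𝔖 i)).tower3.toRunObjects k ((X i).UkH k (Hist.triv (Sc i).P k) W) = W)
    (h2 : B10.Thm2Printed fun i => (towerOf 𝔎 (X i) (𝔖 i)).toRunData) (i : I) (k : ℕ) (hk : k ≤ (Sc i).K) :
    (inputOf 𝔎 (X i) (𝔖 i)).tower3.Ineq47Literal k :=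
  ineq47Literal_of_thm2Printed Sc (fun i => inputOf 𝔎 (X i) (𝔖 i)) hav hcons (fun _ _ _ => le_rfl) h2 i k hk

/-! ## §4 (37) p. 265 AS PRINTED from (47)₁ AS PRINTED: the threshold comparison `g₀p(g₁)L⁻² ≤ g₁p(g₁)L⁻²` discharged -/

omit [MeasurableMul₂ G] in
/-- The printed thresholds of (37) p. 265 («|U₁(∂p) − 1| < L⁻²g₀p(g₁)» ⟦sic⟧) and of (47) at `k = 1` («g₁p(g₁)η²», η = L⁻¹) compare as
`g₀p(g₁)L⁻² ≤ g₁p(g₁)L⁻²`: the couplings `g_k = g(L^kε)^{1/2}` GROW with `k` in d = 3 (`ScalesArithmetic.gk_mono`) and `p(g₁) ≥ 0` for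
`g₁ ≤ 1` (`K ≥ 1`, `B10.pFun_nonneg`, `b₀ ≥ 0`) — the hypothesis `hthr` of `SectBLowerBound.ineq37Literal_of_ineq47Literal_one`,
DISCHARGED for the spine's lattice approximations. [cite: Balaban1985UV3, (37) p.265 + (47) p.267 + (5) p.256] -/
theorem threshold37_le (W : SectB.TowerObjects S G) (hb : 0 ≤ W.b₀) (hK : 1 ≤ S.K) :
    S.gk 0 * B10.pFun W.b₀ W.p₀ (S.gk 1) * S.eta 1 ^ 2 ≤ S.gk 1 * B10.pFun W.b₀ W.p₀ (S.gk 1) * S.eta 1 ^ 2 :=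
  mul_le_mul_of_nonneg_right
    (mul_le_mul_of_nonneg_right (ScalesArithmetic.gk_mono S zero_le_one)
      (B10.pFun_nonneg _ _ _ hb (ScalesArithmetic.gk_pos S 1) (ScalesArithmetic.gk_le_one S S.gK_le_one 1 hK)))
    (sq_nonneg _)

omit [MeasurableMul₂ G] in
/-- **(47)₁ AS PRINTED ⇒ (37) AS PRINTED**, unconditionally on the thresholds (`b₀ ≥ 0`, `K ≥ 1`): the spine's
`SectBLowerBound.ineq37Literal_of_ineq47Literal_one` with `hthr := threshold37_le`. [cite: Balaban1985UV3, (37) p.265 + (47) p.267] -/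
theorem ineq37Literal_of_ineq47Literal_one (W : SectB.TowerObjects S G) (hb : 0 ≤ W.b₀) (hK : 1 ≤ S.K)
    (h : W.Ineq47Literal 1) : W.Ineq37Literal :=
  W.ineq37Literal_of_ineq47Literal_one (threshold37_le W hb hK) h

omit [MeasurableMul₂ G] in
/-- **(37) AS PRINTED ON `D.tower3` FROM ITS SLOT AT `k = 1`** (Sect. A's lower bound with its own `χ₁`): (42) at the trivial history for
the axial averaging at `k = 1` («Ū(U₁(V)) = V» on `T₁`), `g₁p(g₁) ≤ ε₁(1)`, `b₀ ≥ 0`, `K ≥ 1` and the slot `(41)₁ ∧ (47)₁` give (37) p. 265 with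
print's `χ₁` for the constructed densities. [cite: Balaban1985UV3, (36)–(37) p.265 + (42) p.266] -/
theorem ineq37Literal_tower3_of_slot (D : TowerInput S G) (hK : 1 ≤ S.K) (hb : 0 ≤ D.b₀)
    (hcons : ∀ V : GaugeField S.P 1 G, axialUp 1 (D.UkH 1 (Hist.triv S.P 1) V) = V)
    (hthr : S.gk 1 * B10.pFun D.b₀ D.p₀ (S.gk 1) ≤ D.ε₁ 1) (hslot : D.tower3.ineq41_47 1) :
    D.tower3.Ineq37Literal :=
  ineq37Literal_of_ineq47Literal_one D.tower3 hb hK (ineq47Literal_tower3_of_slot D 1 (by omega) hcons hthr hslot)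

end Summit.QuantumFields.YangMills.Theorems.BalabanUVNodesN08Ineq47AsPrinted
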